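import Summits.AtomisticToContinuum.Crystallization.Theorems.PalmUnimodularRigidityLayeredLawsSelectHcpSelectionNullCubic
import Summits.AtomisticToContinuum.Crystallization.Theorems.PalmUnimodularRigidityLayeredLawsSelectHcpMassTransport
import Summits.AtomisticToContinuum.Crystallization.Theorems.PalmUnimodularRigidityUnimodularEnergyLowerBoundTransport

/-!
# Crux `LayeredLawsSelectHcp` (stmt-AtomisticToContinuum-9226), line `mtp-prestress-split-ergodic-frame`,
# selection core: FAULT-ADJACENCY CHARGING by mass transport

Registered sub-goal `tube_faultAdjacencyCharging` (verbatim the body of `FaultAdjacencyCharging` of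
`Cruxes/LayeredLawsSelectHcp/StrategistOneSketch.lean`): under a point-stationary layered probability law `P`,
the event "some cubic (faulted) site of the configuration lies within distance `R` of the root" has probability
at most `N_R · P(cubicRoot)`, `N_R = (4R/δ + 1)³`, `δ = 891/1000` the hard core of layered laws
(`Negative.RootedRedundant.rooted_of_pointStationary_layered`).

Proof.  (1) A MEASURABLE VERSION of the event `cubicRoot` (`exists_measurableSet_cubicVersion`): the site
predicates `IsHexSite` / `IsCubicSite` quantify over the uncountably many points of space and are not manifestly
measurable in the configuration; but "some `p, q, t, b ∈ S` realise the hexagonal distance pattern around `0`"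
reads, on a counting measure `μ = count|S`, as the non-vanishing of the fourfold iterated Campbell integral of the
(Borel) pattern indicator against `μ`, and iterated integrals against an s-FINITE kernel are measurable in the
kernel argument (`Measurable.lintegral_kernel_prod_right`); the s-finite modification `κ` of the identity kernel
(`exists_isSFiniteKernel_apply_eq_self`) agrees with the identity on the locally finite configurations `count|S`,
`S` separated.  So `C = {μ | μ {0} ≠ 0 ∧ (iterated κ-integral of the pattern indicator) = 0}` is a measurable set
of measures with `count|S ∈ C ↔ IsCubicSite S 0` for every separated `S` (`exists_measurableSet_patternVersion`,
written for a general proper normed group).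
(2) Almost surely `μ = count|S` with `0 ∈ S`, `S` `δ`-separated; if some `y ∈ S` with `‖y‖ ≤ R` is cubic then the
re-rooted configuration `θ_y μ = count|(S - y)` lies in `C` (translation covariance `isCubicSite_image_sub_zero_iff`),
so `F μ = ∫⁻ y in B̄(0, R), 1_C (θ_y μ) ∂μ ≥ 1`; `F` is a.e.-measurable (again through `κ`), whence MARKOV:
`P(event) ≤ P(1 ≤ F) ≤ E[F]`.  (3) MASS TRANSPORT (`tube_setLIntegral_shift_symm`, symmetric window `B̄(0, R)`):
`E[F] = E[1_C(μ) · μ(B̄(0, R))]`.  (4) HARD CORE: `μ(B̄(0, R)) = #(S ∩ B̄(0, R)) ≤ (2R/δ + 1)³ ≤ N_R`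
(`UnimodularEnergy.count_restrict_closedBall_le`), so `E[F] ≤ N_R · P C = N_R · P(cubicRoot)` (`C` and `cubicRoot`
agree almost surely).  All `[folklore]`; the transport step is LastPenrose2017, Theorem 9.4 (mass-transport form
of the Mecke equation), already landed as `tube_weightedTransport`.
-/

noncomputable section

namespace Summit.AtomisticToContinuum.Crystallization.Theorems.PalmUnimodularRigidity.LayeredLawsSelectHcp

open MeasureTheory ProbabilityTheory Set Metric
open scoped ENNReal
open Literature.Probability.Process (map_sub_count_restrict count_restrict_singleton_ne_zero_iff)
open Summit.AtomisticToContinuum.Crystallization.Theorems.LayeredLawsSelectHcp.Negative.DiracLaws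
  (PointStationary Layered count_restrict_singleton)
open Summit.AtomisticToContinuum.Crystallization.Theorems.LayeredLawsSelectHcp.Negative.RootedRedundant
  (rooted_of_pointStationary_layered)
open Summit.AtomisticToContinuum.Crystallization.Theorems.UnimodularEnergy (count_restrict_closedBall_le)

/-! ## Measurable iterated kernel integrals -/

section Kernel

variable {E : Type*} [MeasurableSpace E]

/-- Parametric Campbell integrals against an s-finite kernel are jointly measurable in the kernel argument and the
parameter (`Measurable.lintegral_kernel_prod_right'` for the s-finite kernel `κ.comap Prod.fst`). [folklore] -/
theorem measurable_lintegral_kernel_param {M X : Type*} [MeasurableSpace M] [MeasurableSpace X]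
    (κ : Kernel M E) [IsSFiniteKernel κ] {g : (M × X) × E → ℝ≥0∞} (hg : Measurable g) :
    Measurable fun a : M × X => ∫⁻ b, g (a, b) ∂(κ a.1) := by
  have h := hg.lintegral_kernel_prod_right' (κ := κ.comap Prod.fst measurable_fst)
  simpa only [Kernel.comap_apply] using h

/-- The fourfold iterated integral of a measurable pattern indicator against an s-finite kernel is measurable in the
kernel argument (three parametric steps and a plain one). [folklore] -/
theorem measurable_iterLIntegral_indicator {M : Type*} [MeasurableSpace M] (κ : Kernel M E) [IsSFiniteKernel κ]
    {D : Set (E × E × E × E × E)} (hD : MeasurableSet D) (y : E) :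
    Measurable fun μ : M =>
      ∫⁻ p, ∫⁻ q, ∫⁻ t, ∫⁻ b, D.indicator 1 (y, p, q, t, b) ∂(κ μ) ∂(κ μ) ∂(κ μ) ∂(κ μ) := by
  have h4 : Measurable fun a : M × E × E × E =>
      ∫⁻ b, D.indicator 1 (y, a.2.1, a.2.2.1, a.2.2.2, b) ∂(κ a.1) :=
    measurable_lintegral_kernel_param κ
      (g := fun c : (M × E × E × E) × E => D.indicator 1 (y, c.1.2.1, c.1.2.2.1, c.1.2.2.2, c.2))
      ((measurable_one.indicator hD).comp (by fun_prop))
  have h3 : Measurable fun a : M × E × E =>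
      ∫⁻ t, ∫⁻ b, D.indicator 1 (y, a.2.1, a.2.2, t, b) ∂(κ a.1) ∂(κ a.1) :=
    measurable_lintegral_kernel_param κ
      (g := fun c : (M × E × E) × E => ∫⁻ b, D.indicator 1 (y, c.1.2.1, c.1.2.2, c.2, b) ∂(κ c.1.1))
      (h4.comp (by fun_prop : Measurable fun c : (M × E × E) × E => (c.1.1, c.1.2.1, c.1.2.2, c.2)))
  have h2 : Measurable fun a : M × E =>
      ∫⁻ q, ∫⁻ t, ∫⁻ b, D.indicator 1 (y, a.2, q, t, b) ∂(κ a.1) ∂(κ a.1) ∂(κ a.1) :=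
    measurable_lintegral_kernel_param κ
      (g := fun c : (M × E) × E => ∫⁻ t, ∫⁻ b, D.indicator 1 (y, c.1.2, c.2, t, b) ∂(κ c.1.1) ∂(κ c.1.1))
      (h3.comp (by fun_prop : Measurable fun c : (M × E) × E => (c.1.1, c.1.2, c.2)))
  exact Measurable.lintegral_kernel_prod_right' (κ := κ)
    (f := fun c : M × E => ∫⁻ q, ∫⁻ t, ∫⁻ b, D.indicator 1 (y, c.2, q, t, b) ∂(κ c.1) ∂(κ c.1) ∂(κ c.1)) h2

end Kernel

/-- A bond window `a < dist (f w) (g w) ≤ b` between continuous maps is a measurable condition. [folklore] -/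
theorem measurable_window {X F : Type*} [TopologicalSpace X] [MeasurableSpace X] [OpensMeasurableSpace X]
    [PseudoMetricSpace F] {f g : X → F} (hf : Continuous f) (hg : Continuous g) (a b : ℝ) :
    Measurable fun w => a < dist (f w) (g w) ∧ dist (f w) (g w) ≤ b :=
  (Measurable.lt measurable_const (hf.dist hg).measurable).and ((hf.dist hg).measurable.le' measurable_const)

/-! ## Measurable versions of four-witness pattern events on a proper normed group -/

section Version

variable {E : Type*} [NormedAddCommGroup E] [MeasurableSpace E] [BorelSpace E]

/-- `∫⁻ g d(count|S) = 0` iff `g` vanishes on `S` (`S` countable). [folklore] -/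
theorem lintegral_count_restrict_eq_zero_iff {S : Set E} (hS : S.Countable) (g : E → ℝ≥0∞) :
    ∫⁻ x, g x ∂((Measure.count : Measure E).restrict S) = 0 ↔ ∀ x ∈ S, g x = 0 := by
  rw [lintegral_countable _ hS, ENNReal.tsum_eq_zero, SetCoe.forall]
  simp only [Measure.count_singleton, mul_one]

variable [ProperSpace E]

/-- **Measurable version of a four-witness pattern event at the root.**  For a measurable `D ⊆ E⁵` there is a
measurable set `C` of measures such that, for every separated `S`, `count|S ∈ C` iff `0 ∈ S` and NO `p, q, t, b ∈ S`
have `(0, p, q, t, b) ∈ D`: `C = {μ | μ {0} ≠ 0 ∧ ∫⁻∫⁻∫⁻∫⁻ 1_D (0, p, q, t, b) d(κ μ)⁴ = 0}` with `κ` the s-finite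
modification of the identity kernel (`κ (count|S) = count|S` for separated `S`, which are locally finite), and on
`count|S` the iterated integral is the iterated sum over `S`. [folklore] -/
theorem exists_measurableSet_patternVersion {D : Set (E × E × E × E × E)} (hD : MeasurableSet D) :
    ∃ C : Set (Measure E), MeasurableSet C ∧ ∀ {δ : ℝ}, 0 < δ → ∀ S : Set E,
      (∀ x ∈ S, ∀ y ∈ S, x ≠ y → δ ≤ dist x y) →
        ((Measure.count : Measure E).restrict S ∈ C ↔
          (0 : E) ∈ S ∧ ¬ ∃ p q t b : E, p ∈ S ∧ q ∈ S ∧ t ∈ S ∧ b ∈ S ∧ ((0 : E), p, q, t, b) ∈ D) := by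
  -- an s-finite kernel agreeing with the identity on locally finite configurations
  obtain ⟨κ, hκ, hκid⟩ := exists_isSFiniteKernel_apply_eq_self
    (fun n : ℕ => (fun z : E => ⌊‖z‖⌋₊) ⁻¹' {n}) measurableSet_floorNorm_preimage
    (fun i j hij => Set.disjoint_iff.2 fun z hz => hij (hz.1.symm.trans hz.2))
    (fun z => ⟨⌊‖z‖⌋₊, rfl⟩)
  refine ⟨{μ | μ {(0 : E)} ≠ 0} ∩
    {μ | ∫⁻ p, ∫⁻ q, ∫⁻ t, ∫⁻ b, D.indicator 1 ((0 : E), p, q, t, b) ∂(κ μ) ∂(κ μ) ∂(κ μ) ∂(κ μ) = 0}, ?_, ?_⟩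
  · exact ((Measure.measurable_coe (measurableSet_singleton (0 : E))) (measurableSet_singleton 0).compl).inter
      (measurable_iterLIntegral_indicator κ hD 0 (measurableSet_singleton 0))
  · intro δ hδ S hsep
    -- `S` is locally finite, hence countable, and `κ (count|S) = count|S`
    have hlf : ∀ n : ℕ, (Measure.count : Measure E).restrict S ((fun z : E => ⌊‖z‖⌋₊) ⁻¹' {n}) < ⊤ :=
      count_restrict_floorNorm_preimage_lt_top hδ hsep
    have hSc : S.Countable := by
      have hS : S = ⋃ n : ℕ, (fun z : E => ⌊‖z‖⌋₊) ⁻¹' {n} ∩ S := by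
        rw [← Set.iUnion_inter, eq_comm, Set.inter_eq_right]
        exact fun z _ => Set.mem_iUnion.2 ⟨⌊‖z‖⌋₊, rfl⟩
      rw [hS]
      refine Set.countable_iUnion fun n => Set.Finite.countable (Measure.count_apply_lt_top.1 ?_)
      rw [← Measure.restrict_apply (measurableSet_floorNorm_preimage n)]
      exact hlf n
    simp only [mem_inter_iff, mem_setOf_eq, hκid _ hlf, count_restrict_singleton_ne_zero_iff,
      lintegral_count_restrict_eq_zero_iff hSc, Set.indicator_apply_eq_zero, Pi.one_apply, one_ne_zero,
      imp_false, not_exists]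
    exact and_congr_right fun _ =>
      ⟨fun h p q t b ⟨hp, hq, ht, hb, hw⟩ => h p hp q hq t ht b hb hw,
        fun h p hp q hq t ht b hb hw => h p q t b ⟨hp, hq, ht, hb, hw⟩⟩

end Version

/-! ## The measurable version of `cubicRoot` -/

/-- The hexagonal site pattern as a MEASURABLE condition on the site and its four witnesses: `t ≠ b` and the nine
bond windows `0 < dist ≤ 28/25` of `IsHexSite`, with the memberships in `S` split off. [folklore] -/
theorem exists_measurableSet_hexPattern :
    ∃ D : Set ((EuclideanSpace ℝ (Fin 3)) × (EuclideanSpace ℝ (Fin 3)) × (EuclideanSpace ℝ (Fin 3)) ×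
        (EuclideanSpace ℝ (Fin 3)) × (EuclideanSpace ℝ (Fin 3))), MeasurableSet D ∧
      ∀ S y, y ∈ S → (IsHexSite S y ↔ ∃ p q t b, p ∈ S ∧ q ∈ S ∧ t ∈ S ∧ b ∈ S ∧ (y, p, q, t, b) ∈ D) := by
  refine ⟨{w | w.2.2.2.1 ≠ w.2.2.2.2 ∧ (0 < dist w.1 w.2.1 ∧ dist w.1 w.2.1 ≤ 28 / 25) ∧
      (0 < dist w.1 w.2.2.1 ∧ dist w.1 w.2.2.1 ≤ 28 / 25) ∧
      (0 < dist w.1 w.2.2.2.1 ∧ dist w.1 w.2.2.2.1 ≤ 28 / 25) ∧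
      (0 < dist w.1 w.2.2.2.2 ∧ dist w.1 w.2.2.2.2 ≤ 28 / 25) ∧
      (0 < dist w.2.1 w.2.2.1 ∧ dist w.2.1 w.2.2.1 ≤ 28 / 25) ∧
      (0 < dist w.2.2.2.1 w.2.1 ∧ dist w.2.2.2.1 w.2.1 ≤ 28 / 25) ∧
      (0 < dist w.2.2.2.1 w.2.2.1 ∧ dist w.2.2.2.1 w.2.2.1 ≤ 28 / 25) ∧
      (0 < dist w.2.2.2.2 w.2.1 ∧ dist w.2.2.2.2 w.2.1 ≤ 28 / 25) ∧
      (0 < dist w.2.2.2.2 w.2.2.1 ∧ dist w.2.2.2.2 w.2.2.1 ≤ 28 / 25)}, ?_, ?_⟩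
  · -- measurable: a finite Boolean combination of (in)equalities between continuous functions
    refine measurableSet_setOf.2 (Measurable.and (Measurable.not (Measurable.eq ?_ ?_)) ?_)
    · fun_prop
    · fun_prop
    exact (measurable_window (by fun_prop) (by fun_prop) _ _).and <|
      (measurable_window (by fun_prop) (by fun_prop) _ _).and <|
      (measurable_window (by fun_prop) (by fun_prop) _ _).and <|
      (measurable_window (by fun_prop) (by fun_prop) _ _).and <|
      (measurable_window (by fun_prop) (by fun_prop) _ _).and <|
      (measurable_window (by fun_prop) (by fun_prop) _ _).and <|
      (measurable_window (by fun_prop) (by fun_prop) _ _).and <|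
      (measurable_window (by fun_prop) (by fun_prop) _ _).and <|
      measurable_window (by fun_prop) (by fun_prop) _ _
  · intro S y hy
    simp only [mem_setOf_eq]
    constructor
    · rintro ⟨p, q, t, b, htb, ⟨-, hp, gxp⟩, ⟨-, hq, gxq⟩, ⟨-, ht, gxt⟩, ⟨-, hb, gxb⟩, ⟨-, -, gpq⟩,
        ⟨-, -, gtp⟩, ⟨-, -, gtq⟩, ⟨-, -, gbp⟩, ⟨-, -, gbq⟩⟩
      exact ⟨p, q, t, b, hp, hq, ht, hb, htb, gxp, gxq, gxt, gxb, gpq, gtp, gtq, gbp, gbq⟩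
    · rintro ⟨p, q, t, b, hp, hq, ht, hb, htb, gxp, gxq, gxt, gxb, gpq, gtp, gtq, gbp, gbq⟩
      exact ⟨p, q, t, b, htb, ⟨hy, hp, gxp⟩, ⟨hy, hq, gxq⟩, ⟨hy, ht, gxt⟩, ⟨hy, hb, gxb⟩, ⟨hp, hq, gpq⟩,
        ⟨ht, hp, gtp⟩, ⟨ht, hq, gtq⟩, ⟨hb, hp, gbp⟩, ⟨hb, hq, gbq⟩⟩

/-- **Measurable version of `cubicRoot`.**  There is a measurable set `C` of configuration measures such that for
every separated `S ⊆ ℝ³`, `count|S ∈ C ↔ IsCubicSite S 0` (`= count|S ∈ cubicRoot`, as `pts (count|S) = S`).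
[folklore] -/
theorem exists_measurableSet_cubicVersion :
    ∃ C : Set (Measure (EuclideanSpace ℝ (Fin 3))), MeasurableSet C ∧ ∀ {δ : ℝ}, 0 < δ →
      ∀ S : Set (EuclideanSpace ℝ (Fin 3)), (∀ x ∈ S, ∀ y ∈ S, x ≠ y → δ ≤ dist x y) →
        ((Measure.count : Measure (EuclideanSpace ℝ (Fin 3))).restrict S ∈ C ↔ IsCubicSite S 0) := by
  obtain ⟨D, hDm, hD⟩ := exists_measurableSet_hexPattern
  obtain ⟨C, hCm, hC⟩ := exists_measurableSet_patternVersion hDm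
  refine ⟨C, hCm, fun hδ S hsep => ?_⟩
  rw [hC hδ S hsep, IsCubicSite]
  exact and_congr_right fun h0 => not_congr (hD S 0 h0).symm

/-! ## The stub -/

/-- **Registered sub-goal `tube_faultAdjacencyCharging` — fault-adjacency charging by mass transport.**  Under a
point-stationary layered probability law, the probability that SOME cubic (faulted) site lies within distance `R` of
the root is at most `(4R/δ + 1)³ · P(cubicRoot)`, `δ = 891/1000`: Markov on the number `F` of cubic sites in
`B̄(0, R)` (counted through the measurable version of `cubicRoot` at the re-rooted configurations), the
mass-transport principle `E[F] = E[1_cubicRoot · μ(B̄(0, R))]` (`tube_setLIntegral_shift_symm`), and the hard-core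
packing bound `μ(B̄(0, R)) ≤ (2R/δ + 1)³`. [folklore] -/
theorem tube_faultAdjacencyCharging :
    ∀ R : ℝ, 0 < R → ∀ P : Measure (Measure (EuclideanSpace ℝ (Fin 3))), IsProbabilityMeasure P →
      PointStationary P → Layered P →
        P {μ | ∃ y : EuclideanSpace ℝ (Fin 3), IsCubicSite (pts μ) y ∧ ‖y‖ ≤ R} ≤
          ENNReal.ofReal ((4 * R / (891 / 1000) + 1) ^ 3) * P cubicRoot := by
  intro R hR P _ hstat hlay
  have hδ : (0 : ℝ) < 891 / 1000 := by norm_num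
  -- the almost sure structure: rooted hard-core counting measures, locally finite
  have hG := rooted_of_pointStationary_layered hstat hlay
  have hlf := ae_locallyFinite_of_layered hstat hlay
  -- the measurable version of `cubicRoot`
  obtain ⟨C, hCm, hC⟩ := exists_measurableSet_cubicVersion
  set f : Measure (EuclideanSpace ℝ (Fin 3)) → ℝ≥0∞ := C.indicator 1 with hf_def
  have hf : Measurable f := measurable_one.indicator hCm
  -- the (symmetric, measurable) window
  set W : Set (EuclideanSpace ℝ (Fin 3)) := closedBall 0 R with hW_def
  have hWm : MeasurableSet W := measurableSet_closedBall
  have hWsymm : (fun y : EuclideanSpace ℝ (Fin 3) => -y) ⁻¹' W = W := by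
    ext y
    simp [hW_def]
  -- the number of `C`-sites in the window, `F μ = Σ_{y ∈ μ ∩ W} 1_C (θ_y μ)`
  set F : Measure (EuclideanSpace ℝ (Fin 3)) → ℝ≥0∞ := fun μ =>
    ∫⁻ y in W, f (Measure.map (fun z => z - y) μ) ∂μ with hF_def
  -- (1) on the event, `1 ≤ F` almost surely
  have h1 : P {μ | ∃ y : EuclideanSpace ℝ (Fin 3), IsCubicSite (pts μ) y ∧ ‖y‖ ≤ R} ≤ P {μ | 1 ≤ F μ} := by
    refine measure_mono_ae ?_
    filter_upwards [hG] with μ ⟨S, _, hsep, hμS⟩ ⟨y, hy, hyR⟩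
    rw [hμS, pts_count_restrict] at hy
    have hyS : y ∈ S := hy.1
    -- the re-rooted configuration is the counting measure of the shifted separated set, cubic at the root
    have hsep' : ∀ x ∈ (fun z => z - y) '' S, ∀ x' ∈ (fun z => z - y) '' S, x ≠ x' →
        (891 / 1000 : ℝ) ≤ dist x x' := by
      rintro _ ⟨a, ha, rfl⟩ _ ⟨b, hb, rfl⟩ hne
      rw [dist_sub_right]
      exact hsep a ha b hb fun h => hne (by rw [h])
    have hfy : f (Measure.map (fun z => z - y) μ) = 1 := by
      rw [hμS, map_sub_count_restrict, hf_def,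
        Set.indicator_of_mem ((hC hδ _ hsep').2 ((isCubicSite_image_sub_zero_iff S y).2 hy)), Pi.one_apply]
    show 1 ≤ F μ
    calc (1 : ℝ≥0∞) = f (Measure.map (fun z => z - y) μ) * μ {y} := by
          rw [hfy, hμS, count_restrict_singleton hyS, one_mul]
      _ = ∫⁻ z in {y}, f (Measure.map (fun w => w - z) μ) ∂μ :=
          (lintegral_singleton (fun z => f (Measure.map (fun w => w - z) μ)) y).symm
      _ ≤ F μ := lintegral_mono_set (singleton_subset_iff.2 (mem_closedBall_zero_iff.2 hyR))
  -- (2) Markov: `F` is a.e.-measurable (a kernel integral on locally finite configurations)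
  obtain ⟨κ, hκ, hκid⟩ := exists_isSFiniteKernel_apply_eq_self
    (fun n : ℕ => (fun z : EuclideanSpace ℝ (Fin 3) => ⌊‖z‖⌋₊) ⁻¹' {n}) measurableSet_floorNorm_preimage
    (fun i j hij => Set.disjoint_iff.2 fun z hz => hij (hz.1.symm.trans hz.2))
    (fun z => ⟨⌊‖z‖⌋₊, rfl⟩)
  have hFae : AEMeasurable F P := by
    have hF' : Measurable fun μ : Measure (EuclideanSpace ℝ (Fin 3)) =>
        ∫⁻ y in W, f ((κ μ).map (fun z => z - y)) ∂(κ μ) :=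
      Measurable.setLIntegral_kernel_prod_right
        (f := fun (μ : Measure (EuclideanSpace ℝ (Fin 3))) (y : EuclideanSpace ℝ (Fin 3)) =>
          f ((κ μ).map (fun z => z - y)))
        (hf.comp (measurable_map_sub_kernel κ)) hWm
    refine ⟨_, hF', ?_⟩
    filter_upwards [hlf] with μ hμ
    simp only [hF_def, hκid μ hμ]
  have h2 : P {μ | 1 ≤ F μ} ≤ ∫⁻ μ, F μ ∂P := by
    have h := mul_meas_ge_le_lintegral₀ hFae 1
    rwa [one_mul] at h
  -- (3) mass transport: `E[F] = E[f · μ W]`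
  have h3 : ∫⁻ μ, F μ ∂P = ∫⁻ μ, f μ * μ W ∂P := tube_setLIntegral_shift_symm hstat hlf hWm hWsymm hf
  -- (4) hard core: `μ W ≤ N_R` almost surely
  have h4 : ∫⁻ μ, f μ * μ W ∂P ≤ ∫⁻ μ, ENNReal.ofReal ((4 * R / (891 / 1000) + 1) ^ 3) * f μ ∂P := by
    refine lintegral_mono_ae ?_
    filter_upwards [hG] with μ ⟨S, _, hsep, hμS⟩
    rw [mul_comm]
    refine mul_le_mul_left ?_ _
    rw [hμS]
    refine (count_restrict_closedBall_le hδ hsep hR.le).trans (ENNReal.ofReal_le_ofReal ?_)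
    have h24 : 2 * R / (891 / 1000) + 1 ≤ 4 * R / (891 / 1000) + 1 := by
      have : 2 * R / (891 / 1000) ≤ 4 * R / (891 / 1000) := div_le_div_of_nonneg_right (by linarith) hδ.le
      linarith
    exact pow_le_pow_left₀ (by positivity) h24 3
  -- (5) `E[f] = P C ≤ P cubicRoot`
  have h5 : ∫⁻ μ, ENNReal.ofReal ((4 * R / (891 / 1000) + 1) ^ 3) * f μ ∂P =
      ENNReal.ofReal ((4 * R / (891 / 1000) + 1) ^ 3) * P C := by
    rw [lintegral_const_mul _ hf, hf_def, lintegral_indicator_one hCm]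
  have h6 : P C ≤ P cubicRoot := by
    refine measure_mono_ae ?_
    filter_upwards [hG] with μ ⟨S, _, hsep, hμS⟩ hμC
    show IsCubicSite (pts μ) 0
    rw [hμS] at hμC ⊢
    rw [pts_count_restrict]
    exact (hC hδ S hsep).1 hμC
  calc P {μ | ∃ y : EuclideanSpace ℝ (Fin 3), IsCubicSite (pts μ) y ∧ ‖y‖ ≤ R} ≤ P {μ | 1 ≤ F μ} := h1
    _ ≤ ∫⁻ μ, F μ ∂P := h2
    _ = ∫⁻ μ, f μ * μ W ∂P := h3
    _ ≤ ∫⁻ μ, ENNReal.ofReal ((4 * R / (891 / 1000) + 1) ^ 3) * f μ ∂P := h4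
    _ = ENNReal.ofReal ((4 * R / (891 / 1000) + 1) ^ 3) * P C := h5
    _ ≤ ENNReal.ofReal ((4 * R / (891 / 1000) + 1) ^ 3) * P cubicRoot := mul_le_mul_right h6 _

end Summit.AtomisticToContinuum.Crystallization.Theorems.PalmUnimodularRigidity.LayeredLawsSelectHcp

end
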